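import Mathlib
import Summits.Ventures.PercRepro2.TB14Hall

/-!
# Row 2′TB: THE TRIVIAL-CORE SLICE — the star flip of `o`'s component is an involution
(blind cell PercRepro2, mine-c g23, 2026-08-26; `conjectures/MINE-C.md` §32.0 (iii))

All-free profile. For a configuration `y` let `T_r`, `T_b` be the red and blue clusters of `a₂`
(`Conn ends y a₂ ·`, `Conn ends (flipOn F y) a₂ ·`), `U := T_r ∪ T_b` and the CORE `K := T_r ∩ T_b`.
The core is TRIVIAL when `K = {a₂}` (`TrivCore`).  Let `C_o` be the component of `o` in the graph
induced on `U ∖ {a₂}` by ALL edges (`oComp`; `o ∈ U ∖ {a₂}` for a source).  On the trivial-core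
slice the STAR FLIP of `C_o` (`TB14FlipFamily.starFlip`, every edge touching `C_o` changes colour)
is an INVOLUTION that exchanges the sources and the targets of row 2′TB:

* `admissible_oComp`: `C_o` is an admissible flip set of a trivial-core source (conditions
  (Z1)–(Z3) of `TB14FlipFamily.Admissible`), so `isTgt_starFlip` makes the flip a target;
* part II (`TB14TrivialCoreInv.lean`): after the flip the red cluster of `a₂` is `T_r ∖ C_o`, the
  blue cluster is `T_b ∪ C_o`, the core stays `{a₂}`, `C_o` is unchanged, the flip is an involution,
  and the trivial-core sources inject into the trivial-core targets (`card_trivSrc_le_card_trivTgt`).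

Census (own code `data/mine-c/g23/code/perfib.c`, mode 16): the sub-fibre sums
`Σ_{x : U₂(x) = U, K = {a₂}, o ∈ T_r ∖ T_b} σ_b(x)` are `≤ 0` on n = 5 ALL (49,200 sub-fibres) and
n = 6 m ≤ 9 (8,231,400), as the theorem says; the slice with a nontrivial core is where the row
stops being fibre-wise (first at n = 7, kit j252244).  Own work; standard axioms.
-/

namespace Summit.Ventures.PercRepro2

namespace TB14TrivialCore

open CovForm A3InactiveTyped TB14FlipFamily TB14Hall

section Defs

variable {V : Type} {E : Type} [DecidableEq E] [Fintype V]
variable (ends : E → Sym2 V) (a₂ o : V) (F : Finset E)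

/-- The ARM set `U ∖ {a₂}`: the vertices other than `a₂` in one of the two clusters of `a₂`. -/
def Arm (y : Config E) (v : V) : Prop :=
  v ≠ a₂ ∧ (Conn ends y a₂ v ∨ Conn ends (flipOn F y) a₂ v)

open scoped Classical in
/-- The configuration with exactly the edges inside the arm set open (every colour). -/
noncomputable def armCfg (y : Config E) : Config E :=
  fun e => decide (∀ x ∈ ends e, Arm ends a₂ F y x)

open scoped Classical in
/-- `C_o`: the component of `o` in the graph induced on `U ∖ {a₂}`. -/
noncomputable def oComp (y : Config E) : Finset V :=
  Finset.univ.filter fun v => Conn ends (armCfg ends a₂ F y) o v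

/-- **Trivial core**: the two clusters of `a₂` meet only at `a₂`. -/
def TrivCore (y : Config E) : Prop :=
  ∀ v, Conn ends y a₂ v → Conn ends (flipOn F y) a₂ v → v = a₂

end Defs

section Lemmas

variable {V : Type} {E : Type} [DecidableEq E] [Fintype V]
variable (ends : E → Sym2 V) (a₁ a₂ b o : V) (F : Finset E)

/-- An open edge of `armCfg` has both ends in the arm set. -/
lemma arm_of_armCfg {y : Config E} {e : E} (he : armCfg ends a₂ F y e = true) {x : V}
    (hx : x ∈ ends e) : Arm ends a₂ F y x := by
  classical
  unfold armCfg at he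
  exact (of_decide_eq_true he) x hx

/-- Membership in `C_o`. -/
lemma mem_oComp_iff (y : Config E) (v : V) :
    v ∈ oComp ends a₂ o F y ↔ Conn ends (armCfg ends a₂ F y) o v := by
  classical
  unfold oComp
  rw [Finset.mem_filter]
  exact ⟨fun h => h.2, fun h => ⟨Finset.mem_univ _, h⟩⟩

/-- An edge inside the arm set is open in `armCfg`. -/
lemma armCfg_eq_true {y : Config E} {e : E} (h : ∀ x ∈ ends e, Arm ends a₂ F y x) :
    armCfg ends a₂ F y e = true := by
  classical
  unfold armCfg
  exact decide_eq_true h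

/-- Every vertex of `C_o` is in the arm set (for `o` in the arm set). -/
lemma arm_of_mem_oComp {y : Config E} (ho : Arm ends a₂ F y o) {v : V}
    (hv : v ∈ oComp ends a₂ o F y) : Arm ends a₂ F y v := by
  have hv' : Conn ends (armCfg ends a₂ F y) o v := (mem_oComp_iff ends a₂ o F y v).1 hv
  refine mem_of_conn_of_closed (ends := ends) (ω := armCfg ends a₂ F y)
    (S := {x : V | Arm ends a₂ F y x}) ?_ ho hv'
  intro x _ z hxz
  obtain ⟨_, e, he, hends⟩ := openGraph_adj.1 hxz
  exact arm_of_armCfg ends a₂ F he (by rw [hends]; exact Sym2.mem_mk_right x z)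

/-- `C_o` is closed under adjacency inside the arm set. -/
lemma mem_oComp_of_adj {y : Config E} (ho : Arm ends a₂ F y o) {v u : V}
    (hv : v ∈ oComp ends a₂ o F y) (hu : Arm ends a₂ F y u) {e : E} (hends : ends e = s(v, u)) :
    u ∈ oComp ends a₂ o F y := by
  have hv' : Conn ends (armCfg ends a₂ F y) o v := (mem_oComp_iff ends a₂ o F y v).1 hv
  have hva : Arm ends a₂ F y v := arm_of_mem_oComp ends a₂ o F ho hv
  have he : armCfg ends a₂ F y e = true := by
    refine armCfg_eq_true ends a₂ F ?_
    intro x hx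
    rw [hends, Sym2.mem_iff] at hx
    rcases hx with rfl | rfl
    · exact hva
    · exact hu
  exact (mem_oComp_iff ends a₂ o F y u).2 (conn_trans hv' (conn_of_openAdj ⟨e, he, hends⟩))

omit [Fintype V] in
/-- `a₂` is not in the arm set. -/
lemma not_arm_a2 (y : Config E) : ¬ Arm ends a₂ F y a₂ := fun h => h.1 rfl

/-- `a₂ ∉ C_o`. -/
lemma a2_not_mem_oComp {y : Config E} (ho : Arm ends a₂ F y o) : a₂ ∉ oComp ends a₂ o F y :=
  fun h => not_arm_a2 ends a₂ F y (arm_of_mem_oComp ends a₂ o F ho h)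

/-- `o ∈ C_o`. -/
lemma o_mem_oComp (y : Config E) : o ∈ oComp ends a₂ o F y :=
  (mem_oComp_iff ends a₂ o F y o).2 (conn_refl _ _ _)

omit [Fintype V] in
/-- A source has `o` in the arm set. -/
lemma arm_o_of_isSrc {y : Config E} (hs : IsSrc ends a₁ a₂ b o F y) : Arm ends a₂ F y o :=
  ⟨fun h => hs.ho' (h ▸ conn_refl _ _ _), Or.inl hs.ho⟩

/-- In a trivial-core source every vertex of `C_o` is in `T_r ∖ T_b`. -/
lemma red_of_mem_oComp (hF : ∀ e, e ∈ F) {y : Config E} (hs : IsSrc ends a₁ a₂ b o F y)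
    (ht : TrivCore ends a₂ F y) {v : V} (hv : v ∈ oComp ends a₂ o F y) :
    Conn ends y a₂ v ∧ ¬ Conn ends (flipOn F y) a₂ v := by
  have hv' : Conn ends (armCfg ends a₂ F y) o v := (mem_oComp_iff ends a₂ o F y v).1 hv
  refine mem_of_conn_of_closed (ends := ends) (ω := armCfg ends a₂ F y)
    (S := {x : V | Conn ends y a₂ x ∧ ¬ Conn ends (flipOn F y) a₂ x}) ?_ ⟨hs.ho, hs.ho'⟩ hv'
  rintro x ⟨hxr, hxb⟩ z hxz
  obtain ⟨_, e, he, hends⟩ := openGraph_adj.1 hxz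
  have hza : Arm ends a₂ F y z := arm_of_armCfg ends a₂ F he (by rw [hends]; exact Sym2.mem_mk_right x z)
  simp only [Set.mem_setOf_eq]
  cases hye : y e with
  | true =>
    have hzr : Conn ends y a₂ z := conn_trans hxr (conn_of_openAdj ⟨e, hye, hends⟩)
    refine ⟨hzr, fun hzb => hza.1 (ht z hzr hzb)⟩
  | false =>
    have hblue : flipOn F y e = true := by unfold flipOn; rw [if_pos (hF e), hye]; rfl
    have hzb : ¬ Conn ends (flipOn F y) a₂ z := fun hzb =>
      hxb (conn_trans hzb (conn_of_openAdj ⟨e, hblue, by rw [hends, Sym2.eq_swap]⟩))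
    refine ⟨?_, hzb⟩
    rcases hza.2 with h | h
    · exact h
    · exact absurd h hzb

omit [Fintype V] in
/-- In a trivial-core configuration a red vertex of the arm set is not blue. -/
lemma not_blue_of_red_arm {y : Config E} (ht : TrivCore ends a₂ F y) {v : V}
    (hv : Arm ends a₂ F y v) (hr : Conn ends y a₂ v) : ¬ Conn ends (flipOn F y) a₂ v :=
  fun hb => hv.1 (ht v hr hb)

/-- **The red route**: from any vertex of `C_o` there is a red route to `a₂` through `C_o` (the
route configuration `routeCfg` of `TB14FlipFamily`). -/
lemma route_of_mem_oComp (hF : ∀ e, e ∈ F) {y : Config E} (hs : IsSrc ends a₁ a₂ b o F y)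
    (ht : TrivCore ends a₂ F y) {v : V} (hv : v ∈ oComp ends a₂ o F y) :
    Conn ends (routeCfg ends (oComp ends a₂ o F y) a₂ y) v a₂ := by
  set Z := oComp ends a₂ o F y with hZ
  have ho : Arm ends a₂ F y o := arm_o_of_isSrc ends a₁ a₂ b o F hs
  have hvr : Conn ends y v a₂ := conn_symm (red_of_mem_oComp ends a₁ a₂ b o F hF hs ht hv).1
  have key : a₂ ∈ {x : V | (x ∈ Z ∧ Conn ends (routeCfg ends Z a₂ y) v x) ∨
      Conn ends (routeCfg ends Z a₂ y) v a₂} := by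
    refine mem_of_conn_of_closed (ends := ends) (ω := y) ?_ (Or.inl ⟨hv, conn_refl _ _ _⟩) hvr
    rintro x hx z hxz
    obtain ⟨_, e, he, hends⟩ := openGraph_adj.1 hxz
    simp only [Set.mem_setOf_eq] at hx ⊢
    rcases hx with ⟨hxZ, hxc⟩ | hdone
    · have hxr : Conn ends y a₂ x := (red_of_mem_oComp ends a₁ a₂ b o F hF hs ht hxZ).1
      have hzr : Conn ends y a₂ z := conn_trans hxr (conn_of_openAdj ⟨e, he, hends⟩)
      have hT : Touch ends Z e := touch_of_ends ends hends hxZ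
      by_cases hza : z = a₂
      · -- the edge `x–a₂` is a route edge
        have hall : ∀ w ∈ ends e, w ∈ Z ∨ w = a₂ := by
          intro w hw
          rw [hends, Sym2.mem_iff] at hw
          rcases hw with rfl | rfl
          · exact Or.inl hxZ
          · exact Or.inr hza
        have hroute : routeCfg ends Z a₂ y e = true := by
          unfold routeCfg
          rw [if_pos ⟨hT, hall⟩]
          exact he
        rw [hza] at hends
        exact Or.inr (conn_trans hxc (conn_of_openAdj ⟨e, hroute, hends⟩))
      · -- `z ∈ C_o` (an arm vertex adjacent to `C_o`) and the edge is a route edge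
        have hzZ : z ∈ Z := mem_oComp_of_adj ends a₂ o F ho hxZ ⟨hza, Or.inl hzr⟩ hends
        have hall : ∀ w ∈ ends e, w ∈ Z ∨ w = a₂ := by
          intro w hw
          rw [hends, Sym2.mem_iff] at hw
          rcases hw with rfl | rfl
          · exact Or.inl hxZ
          · exact Or.inl hzZ
        have hroute : routeCfg ends Z a₂ y e = true := by
          unfold routeCfg
          rw [if_pos ⟨hT, hall⟩]
          exact he
        exact Or.inl ⟨hzZ, conn_trans hxc (conn_of_openAdj ⟨e, hroute, hends⟩)⟩
    · exact Or.inr hdone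
  simp only [Set.mem_setOf_eq] at key
  rcases key with ⟨h, _⟩ | h
  · exact absurd h (a2_not_mem_oComp ends a₂ o F ho)
  · exact h

/-- **`C_o` is an admissible flip set** of a trivial-core source. -/
theorem admissible_oComp (hF : ∀ e, e ∈ F) {y : Config E} (hs : IsSrc ends a₁ a₂ b o F y)
    (ht : TrivCore ends a₂ F y) : Admissible ends a₁ a₂ o F (oComp ends a₂ o F y) y := by
  have ho : Arm ends a₂ F y o := arm_o_of_isSrc ends a₁ a₂ b o F hs
  refine ⟨fun v hv => red_of_mem_oComp ends a₁ a₂ b o F hF hs ht hv, o_mem_oComp ends a₂ o F y,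
    ⟨a₂, conn_refl _ _ _, route_of_mem_oComp ends a₁ a₂ b o F hF hs ht (o_mem_oComp ends a₂ o F y)⟩,
    ?_, ?_⟩
  · -- (Z2)
    rintro v hv u ⟨e, -, hends⟩ hur hub
    have hua : u ≠ a₂ := fun h => hub (h ▸ conn_refl _ _ _)
    exact mem_oComp_of_adj ends a₂ o F ho hv ⟨hua, Or.inl hur⟩ hends
  · -- (Z3)
    rintro v hv u ⟨e, he, hends⟩ hu₁
    have hvr : Conn ends y a₂ v := (red_of_mem_oComp ends a₁ a₂ b o F hF hs ht hv).1
    have hur : Conn ends y a₂ u := conn_trans hvr (conn_of_openAdj ⟨e, he, hends⟩)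
    have hub : ¬ Conn ends (flipOn F y) a₂ u := fun hub => hs.q₂ (conn_trans hu₁ (conn_symm hub))
    have hua : u ≠ a₂ := fun h => hub (h ▸ conn_refl _ _ _)
    exact mem_oComp_of_adj ends a₂ o F ho hv ⟨hua, Or.inl hur⟩ hends

/-- **The flip of a trivial-core source is a target.** -/
theorem isTgt_starFlip_oComp (hF : ∀ e, e ∈ F) {y : Config E} (hs : IsSrc ends a₁ a₂ b o F y)
    (ht : TrivCore ends a₂ F y) :
    IsTgt ends a₁ a₂ b o F (starFlip ends (oComp ends a₂ o F y) y) :=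
  isTgt_starFlip ends a₁ a₂ b o F hF hs (admissible_oComp ends a₁ a₂ b o F hF hs ht)

end Lemmas

end TB14TrivialCore

end Summit.Ventures.PercRepro2
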